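import Literature.Geometry.Riemannian.LevelSetMeanCurvature
import Mathlib.Analysis.Calculus.DerivativeTest
import Mathlib.Analysis.InnerProductSpace.Calculus
import HarnessLib

/-!
# Hypersurfaces of Euclidean space: the second fundamental form along chart-straight curves,
# and the comparison of mean curvatures at a distance-minimising pair

Topic `Literature/Geometry/Riemannian`. The pointwise geometry behind the COMPARISON (AVOIDANCE)
PRINCIPLE for mean curvature flow in `ℝⁿ⁺¹` (C. Mantegazza, *Lecture Notes on Mean Curvature
Flow* (2011), Thm. 2.2.1; M. Ritoré–C. Sinestrari, *Mean Curvature Flow and Isoperimetric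
Inequalities* (2010), Thm. 4.2), written in the tree's hypersurface vocabulary
(`Hypersurface.lean`: `K_ν(v, w) = g(D_v ν, df w)`, `H = tr_{f^*g} K`, sign: round spheres with the
outward normal have `H > 0`) for the FLAT metric `euclideanMetric W` of a finite-dimensional real
inner product space `W` and immersions `f : N → W` of manifolds `N` modelled on a boundaryless
model `I'`. Everything is PROVED; no definitions, no named facts.

* **Chart-straight curves.** For `y : N`, `u ∈ T_y N`, the curve `c = curveThrough I' y u`
  (`t ↦ φ⁻¹(φ y + t u)`, `φ` the extended chart at `y`; `Geodesic.lean`) is `C^∞` for small `t`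
  (`contMDiffAt_curveThrough`), and for `f : N → W` smooth, `β = f ∘ c` is a smooth curve of `W`
  with `β'(t) = df_{c t}(c'(t))` and `β'(0) = df_y u`
  (`hasDerivAt_comp_curveThrough`, `hasDerivAt_comp_curveThrough_zero`).
* **The flat covariant derivative along a curve is the ordinary derivative**
  (`covariantDerivAlong_eq_of_hasDerivAt`: O'Neill 1983, Ch. 3, Lemma 3.14 / Prop. 3.18 on the
  model space: the coordinate frame is constant and parallel), hence for a field `ν` along `f`
  the tree's `normalDerivAlong` is `D_v ν = dν_y v` (`normalDerivAlong_eq_mfderiv`) and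
  **`K_ν(v, w) = ⟪dν_y v, df_y w⟫`** (`secondFundamentalForm_eq_inner`).
* **`K_ν(u, u) = -⟪ν(y), β''(0)⟫`, `β = f ∘ curveThrough I' y u`**
  (`secondFundamentalForm_self_eq_neg_inner`; differentiate `⟪ν(c t), β'(t)⟫ = 0`), and the trace
  formula **`H(y) = -⟪ν(y), ∑ᵢ βᵢ''(0)⟫`** over any `f^*δ`-orthonormal basis `bᵢ` of `T_y N`,
  `βᵢ = f ∘ curveThrough I' y bᵢ` (`meanCurvature_eq_neg_inner_sum`). This is the classical
  `H = -⟪ν, Δ_g f⟫` / "`-H ν` is the mean curvature vector" (Mantegazza 2011, §1.1).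
* **Comparison at a distance-minimising pair** (`inner_meanCurvature_smul_sub_nonneg`, the heart
  of Mantegazza 2011, proof of Thm. 2.2.1): if `f₁ : N₁ → W`, `f₂ : N₂ → W` are immersed
  hypersurfaces (`dim N + 1 = dim W`) with unit normals `ν₁, ν₂`, and `(p, q)` minimises
  `‖f₁ p' - f₂ q'‖` over `N₁ × N₂`, then
  `⟪H₂(q) ν₂(q) - H₁(p) ν₁(p), f₁ p - f₂ q⟫ ≥ 0`.
  Proof: with `w = f₁ p - f₂ q ≠ 0`, the first-order conditions make `w` normal to both
  (`inner_mfderiv_eq_zero_of_forall_norm_le`), so `w = ⟪νᵢ, w⟫ νᵢ`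
  (`eq_inner_smul_of_forall_inner_eq_zero`) and the two tangent hyperplanes coincide
  (`range_eq_range_of_forall_inner_eq_zero`); for matched directions `df₂ u' = df₁ u` the
  one-variable second-order condition for `s ↦ ‖f₁(c₁ s) - f₂(c₂ s)‖²` at its minimum `s = 0`
  (`deriv2_nonneg_of_isLocalMin`, `second_order_pair`) reads `⟪w, β₁''(0) - β₂''(0)⟫ ≥ 0`, i.e.
  `-⟪ν₁, w⟫ K₁(u, u) + ⟪ν₂, w⟫ K₂(u', u') ≥ 0`; summing over an `f₁^*δ`-orthonormal basis and its
  matched `f₂^*δ`-orthonormal basis (`exists_basis_eq`) gives the claim. In a mean curvature flow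
  `∂ₜFᵢ = -Hᵢ νᵢ`, so this is exactly `∂ₜ ‖F₁(p) - F₂(q)‖² ≥ 0` at a minimising pair — the input
  of Hamilton's trick (`Literature/Analysis/Calculus/HamiltonMinimumTrick.lean`).

## References

* C. Mantegazza, *Lecture Notes on Mean Curvature Flow*, Progress in Mathematics 290,
  Birkhäuser 2011, §1.1 and Thm. 2.2.1 (proof). [Mantegazza2011]
* M. Ritoré, C. Sinestrari, *Mean Curvature Flow and Isoperimetric Inequalities*, Adv. Courses
  in Math. CRM Barcelona, Birkhäuser 2010, Part II (Sinestrari), Thm. 4.2. [RitoreSinestrari2010]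
* B. O'Neill, *Semi-Riemannian geometry* (1983), Ch. 3, Lemma 3.14, Prop. 3.18; Ch. 4,
  Lemma 4.1 and pp. 98–100. [ONeill1983]
-/

noncomputable section

open Bundle Set Function Metric Module Filter
open scoped Manifold ContDiff Topology RealInnerProductSpace

namespace Literature.Geometry.Riemannian

open Lorentzian Lorentzian.PseudoRiemannianMetric

namespace EuclideanHypersurface

/-! ### Chart-straight curves through a point and curves `f ∘ c` in the ambient vector space -/

section Curve

variable {E' : Type*} [NormedAddCommGroup E'] [NormedSpace ℝ E'] {H' : Type*} [TopologicalSpace H']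
  {I' : ModelWithCorners ℝ E' H'} [I'.Boundaryless] {N : Type*} [TopologicalSpace N]
  [ChartedSpace H' N] [IsManifold I' ∞ N]
  {W : Type*} [NormedAddCommGroup W] [NormedSpace ℝ W]

omit [IsManifold I' ∞ N] in
/-- For small `t` the chart-straight line `φ y + t u` stays in the (open) target of the extended
chart `φ` at `y`. [folklore] -/
theorem eventually_lineThrough_mem_target (y : N) (u : TangentSpace I' y) :
    ∀ᶠ t : ℝ in 𝓝 0, extChartAt I' y y + t • (show E' from u) ∈ (extChartAt I' y).target := by
  have hc : Continuous fun t : ℝ ↦ extChartAt I' y y + t • (show E' from u) := by fun_prop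
  have h0 : extChartAt I' y y + (0 : ℝ) • (show E' from u) ∈ (extChartAt I' y).target := by
    rw [zero_smul, add_zero]
    exact mem_extChartAt_target y
  exact hc.continuousAt.eventually_mem ((isOpen_extChartAt_target y).mem_nhds h0)

/-- The chart-straight curve `curveThrough I' y u : t ↦ φ⁻¹(φ y + t u)` is `C^∞` at every
parameter `t` whose chart point `φ y + t u` lies in the chart target (boundaryless model: `φ⁻¹` is
`C^∞` on the open target). O'Neill 1983, Ch. 1, proof of Prop. 1.16 (coordinate curves).
[cite: ONeill1983, Ch. 1, Prop. 1.16] -/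
theorem contMDiffAt_curveThrough (y : N) (u : TangentSpace I' y) {t : ℝ}
    (ht : extChartAt I' y y + t • (show E' from u) ∈ (extChartAt I' y).target) :
    ContMDiffAt 𝓘(ℝ, ℝ) I' ∞ (curveThrough I' y u) t := by
  have h1 : ContMDiffAt 𝓘(ℝ, E') I' ∞ (extChartAt I' y).symm
      (extChartAt I' y y + t • (show E' from u)) :=
    (contMDiffOn_extChartAt_symm y).contMDiffAt ((isOpen_extChartAt_target y).mem_nhds ht)
  have h2 : ContMDiff 𝓘(ℝ, ℝ) 𝓘(ℝ, E') ∞ (fun t : ℝ ↦ extChartAt I' y y + t • (show E' from u)) :=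
    (contDiff_const.add (contDiff_id.smul contDiff_const)).contMDiff
  exact h1.comp t h2.contMDiffAt

/-- For `f : N → W` smooth, the curve `f ∘ curveThrough I' y u` of `W` is `C^∞` at every such
parameter. [folklore] -/
theorem contDiffAt_comp_curveThrough {f : N → W} (hf : ContMDiff I' 𝓘(ℝ, W) ∞ f) (y : N)
    (u : TangentSpace I' y) {t : ℝ}
    (ht : extChartAt I' y y + t • (show E' from u) ∈ (extChartAt I' y).target) :
    ContDiffAt ℝ ∞ (f ∘ curveThrough I' y u) t :=
  ((hf _).comp t (contMDiffAt_curveThrough y u ht)).contDiffAt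

/-- Hence `f ∘ curveThrough I' y u` is `C^∞` at all parameters near `0`. [folklore] -/
theorem eventually_contDiffAt_comp_curveThrough {f : N → W} (hf : ContMDiff I' 𝓘(ℝ, W) ∞ f)
    (y : N) (u : TangentSpace I' y) :
    ∀ᶠ t : ℝ in 𝓝 0, ContDiffAt ℝ ∞ (f ∘ curveThrough I' y u) t := by
  filter_upwards [eventually_lineThrough_mem_target y u] with t ht
  exact contDiffAt_comp_curveThrough hf y u ht

/-- **Chain rule along a chart-straight curve**: `(f ∘ c)'(t) = df_{c t}(c'(t))`, `c'(t)` the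
velocity (`Lorentzian.velocity`) of `c = curveThrough I' y u`. O'Neill 1983, Ch. 1, Lemma 1.15
and Def. 1.17 (4). [cite: ONeill1983, Ch. 1, Lemma 1.15] -/
theorem hasDerivAt_comp_curveThrough {f : N → W} (hf : ContMDiff I' 𝓘(ℝ, W) ∞ f) (y : N)
    (u : TangentSpace I' y) {t : ℝ}
    (ht : extChartAt I' y y + t • (show E' from u) ∈ (extChartAt I' y).target) :
    HasDerivAt (f ∘ curveThrough I' y u)
      ((mfderiv I' 𝓘(ℝ, W) f (curveThrough I' y u t) :
        TangentSpace I' (curveThrough I' y u t) →L[ℝ] W) (velocity I' (curveThrough I' y u) t)) t := by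
  have hc : MDifferentiableAt 𝓘(ℝ, ℝ) I' (curveThrough I' y u) t :=
    (contMDiffAt_curveThrough y u ht).mdifferentiableAt (by simp)
  have hfd : MDifferentiableAt I' 𝓘(ℝ, W) f (curveThrough I' y u t) :=
    (hf _).mdifferentiableAt (by simp)
  have hd : DifferentiableAt ℝ (f ∘ curveThrough I' y u) t :=
    (contDiffAt_comp_curveThrough hf y u ht).differentiableAt (by simp)
  have h1 : deriv (f ∘ curveThrough I' y u) t =
      (mfderiv I' 𝓘(ℝ, W) f (curveThrough I' y u t) :
        TangentSpace I' (curveThrough I' y u t) →L[ℝ] W) (velocity I' (curveThrough I' y u) t) := by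
    have h2 := mfderiv_comp t hfd hc
    have h3 : mfderiv 𝓘(ℝ, ℝ) 𝓘(ℝ, W) (f ∘ curveThrough I' y u) t =
        fderiv ℝ (f ∘ curveThrough I' y u) t := mfderiv_eq_fderiv
    rw [← fderiv_apply_one_eq_deriv, ← h3, h2]
    rfl
  rw [← h1]
  exact hd.hasDerivAt

/-- At `t = 0`: `(f ∘ curveThrough I' y u)'(0) = df_y u` (`velocity_curveThrough_zero`).
[cite: ONeill1983, Ch. 1, Prop. 1.16 and Exercise 5] -/
theorem hasDerivAt_comp_curveThrough_zero {f : N → W} (hf : ContMDiff I' 𝓘(ℝ, W) ∞ f) (y : N)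
    (u : TangentSpace I' y) :
    HasDerivAt (f ∘ curveThrough I' y u)
      ((mfderiv I' 𝓘(ℝ, W) f y : TangentSpace I' y →L[ℝ] W) u) 0 := by
  have h0 : extChartAt I' y y + (0 : ℝ) • (show E' from u) ∈ (extChartAt I' y).target := by
    rw [zero_smul, add_zero]
    exact mem_extChartAt_target y
  have h := hasDerivAt_comp_curveThrough hf y u h0
  rwa [velocity_curveThrough_zero_holds BoundarylessManifold.isInteriorPoint u,
    curveThrough_zero] at h

omit [I'.Boundaryless] [IsManifold I' ∞ N] in
/-- A curve of `W` which is `C^∞` at `t` has a differentiable derivative there: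
`(β')' (t) = β''(t)` in the sense of `HasDerivAt`. [folklore] -/
theorem hasDerivAt_deriv_of_contDiffAt {β : ℝ → W} {t : ℝ} (hβ : ContDiffAt ℝ ∞ β t) :
    HasDerivAt (deriv β) (deriv (deriv β) t) t := by
  have h1 : ContDiffAt ℝ ∞ (fderiv ℝ β) t := hβ.fderiv_right (m := ∞) (by simp)
  have h2 : ContDiffAt ℝ ∞ (fun s ↦ fderiv ℝ β s (1 : ℝ)) t :=
    (ContinuousLinearMap.apply ℝ W (1 : ℝ)).contDiff.contDiffAt.comp t h1
  have h3 : (fun s ↦ fderiv ℝ β s (1 : ℝ)) = deriv β := by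
    funext s; rfl
  rw [h3] at h2
  exact (h2.differentiableAt (by simp)).hasDerivAt

end Curve

/-! ### The model space: constant coordinate frame, flat covariant derivative along curves -/

section ModelSpace

variable {W : Type*} [NormedAddCommGroup W] [InnerProductSpace ℝ W]

/-- The preferred trivialisation of `TW` at `x` (the identity) has base set all of `W`
(as `ModelSpace.mem_baseSet_trivializationAt` of `CauchyProblemProofs.lean`, restated to keep the
import closure small). [folklore] -/
theorem mem_baseSet_trivializationAt (x y : W) :
    y ∈ (trivializationAt W (TangentSpace 𝓘(ℝ, W)) x).baseSet := by
  simp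

/-- The inverse of the preferred trivialisation of `TW` is the identity on fibres. [folklore] -/
theorem trivializationAt_symm_apply (x y v : W) :
    (trivializationAt W (TangentSpace 𝓘(ℝ, W)) x).symm y v = v := by
  have h := (trivializationAt W (TangentSpace 𝓘(ℝ, W)) x).apply_mk_symm
    (mem_baseSet_trivializationAt x y) v
  rw [trivializationAt_model_space_apply] at h
  exact congrArg Prod.snd h

/-- **The coordinate frame of the model space is constant**: `sᵢ = (y ↦ bᵢ)` (O'Neill 1983,
Ch. 3, Lemma 3.14: natural coordinate vector fields). [cite: ONeill1983, Ch. 3, Lemma 3.14] -/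
theorem localFrame_trivializationAt {ι : Type*} (x : W) (b : Module.Basis ι ℝ W) (i : ι) :
    (trivializationAt W (TangentSpace 𝓘(ℝ, W)) x).localFrame b i = fun _ : W ↦ (b i : W) := by
  funext y
  rw [Trivialization.localFrame_apply_of_mem_baseSet _ _ (mem_baseSet_trivializationAt x y)]
  simp only [Trivialization.basisAt, Module.Basis.map_apply,
    Trivialization.linearEquivAt_symm_apply]
  exact trivializationAt_symm_apply x y (b i)

/-- The coefficient functionals of the constant frame are the coordinate functionals of the basis:
`cⁱ_y(w) = bⁱ(w)`. [folklore] -/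
theorem localFrame_coeff_trivializationAt {ι : Type*} (x : W) (b : Module.Basis ι ℝ W) (i : ι)
    (y w : W) :
    (trivializationAt W (TangentSpace 𝓘(ℝ, W)) x).localFrame_coeff 𝓘(ℝ, W) b i y w = b.repr w i := by
  rw [(trivializationAt W (TangentSpace 𝓘(ℝ, W)) x).localFrame_coeff_eq_coeff (I := 𝓘(ℝ, W))
    (b := b) (s := fun _ : W ↦ (w : W)) (mem_baseSet_trivializationAt x y)]
  simp only [trivializationAt_model_space_apply]

variable [FiniteDimensional ℝ W] [(euclideanMetric W).HasLeviCivita]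

/-- **Constant fields are parallel** for the Levi-Civita connection of the Euclidean metric:
`∇_{X₀} (y ↦ v) = 0` (the connection is the ordinary derivative,
`leviCivita_euclideanMetric_apply`). O'Neill 1983, Ch. 3, Lemma 3.14.
[cite: ONeill1983, Ch. 3, Lemma 3.14] -/
theorem leviCivita_const (x v : W) (X₀ : W) :
    (euclideanMetric W).leviCivita (fun _ : W ↦ (v : W)) x X₀ = 0 := by
  have h2 : ContMDiffAt 𝓘(ℝ, W) 𝓘(ℝ, W).tangent 2
      (fun y ↦ (TotalSpace.mk' W y ((fun _ : W ↦ (v : W)) y) : TangentBundle 𝓘(ℝ, W) W)) x :=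
    contMDiffAt_section_of_contDiffAt contDiffAt_const
  rw [leviCivita_euclideanMetric_apply h2]
  simp [mvfderiv]
  rfl

/-- **The flat covariant derivative along a curve is the ordinary derivative**: for any curve `γ`
of `W` and any field `V` along it (a curve of `W`) with `V'(t₀) = V'`, the covariant derivative
`DV/dt (t₀)` of the Euclidean Levi-Civita connection is `V'` (local-frame formula
`∑ᵢ (cⁱ)' sᵢ + ∑ᵢ cⁱ ∇_{γ'} sᵢ` with constant parallel frame). O'Neill 1983, Ch. 3, Prop. 3.18
with Lemma 3.14. [cite: ONeill1983, Ch. 3, Prop. 3.18] -/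
theorem covariantDerivAlong_eq_of_hasDerivAt {γ : ℝ → W} {V : ℝ → W} {t₀ : ℝ} {V' : W}
    (hV : HasDerivAt V V' t₀) :
    covariantDerivAlong (euclideanMetric W).leviCivita γ V t₀ = V' := by
  rw [covariantDerivAlong_def]
  simp only [covariantDerivAlongFrame, localFrame_trivializationAt,
    localFrame_coeff_trivializationAt, leviCivita_const, smul_zero, Finset.sum_const_zero,
    add_zero]
  set b := Module.finBasis ℝ W
  have h : ∀ i, deriv (fun t ↦ b.repr (V t) i) t₀ = b.repr V' i := fun i ↦ by
    have hL : HasDerivAt (fun t ↦ (b.coord i) (V t)) ((b.coord i) V') t₀ :=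
      ((LinearMap.toContinuousLinearMap (b.coord i)).hasFDerivAt).comp_hasDerivAt t₀ hV
    exact hL.deriv
  simp_rw [h]
  exact b.sum_repr V'

end ModelSpace

/-! ### The second fundamental form of a hypersurface of Euclidean space -/

section Flat

variable {E' : Type*} [NormedAddCommGroup E'] [NormedSpace ℝ E']
  {H' : Type*} [TopologicalSpace H'] {I' : ModelWithCorners ℝ E' H'}
  {N : Type*} [TopologicalSpace N] [ChartedSpace H' N]
  {W : Type*} [NormedAddCommGroup W] [InnerProductSpace ℝ W]

/-- **Unbundling**: a field `ν` along `f : N → W` whose lift `y ↦ (f y, ν y) ∈ TW` is `C^k` is a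
`C^k` map `N → W`, and so is `f` (the tangent bundle of the model space is trivialised by the
identity). [folklore] -/
theorem contMDiff_of_contMDiff_lift {f ν : N → W} {k : ℕ∞ω}
    (h : ContMDiff I' 𝓘(ℝ, W).tangent k
      (fun y ↦ (TotalSpace.mk' W (f y) (ν y) : TangentBundle 𝓘(ℝ, W) W))) :
    ContMDiff I' 𝓘(ℝ, W) k f ∧ ContMDiff I' 𝓘(ℝ, W) k ν := by
  refine ⟨fun y ↦ ?_, fun y ↦ ?_⟩
  · have hy := h y
    rw [ModelWithCorners.tangent, contMDiffAt_totalSpace] at hy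
    exact hy.1
  · have hy := h y
    rw [ModelWithCorners.tangent, contMDiffAt_totalSpace] at hy
    simpa only [trivializationAt_model_space_apply] using hy.2

/-- **Bundling**: conversely, `C^k` maps `f, ν : N → W` give a `C^k` lift `y ↦ (f y, ν y) ∈ TW`.
[folklore] -/
theorem contMDiff_lift_of_contMDiff {f ν : N → W} {k : ℕ∞ω} (hf : ContMDiff I' 𝓘(ℝ, W) k f)
    (hν : ContMDiff I' 𝓘(ℝ, W) k ν) :
    ContMDiff I' 𝓘(ℝ, W).tangent k
      (fun y ↦ (TotalSpace.mk' W (f y) (ν y) : TangentBundle 𝓘(ℝ, W) W)) := by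
  intro y
  rw [ModelWithCorners.tangent, contMDiffAt_totalSpace]
  refine ⟨hf y, ?_⟩
  simpa only [trivializationAt_model_space_apply] using hν y

/-- Differentiability of the lift `y ↦ (f y, ν y) ∈ TW` from that of `f` and `ν` (the hypothesis
of `secondFundamentalForm_apply`). [folklore] -/
theorem mdifferentiableAt_lift {f ν : N → W} {y : N} (hf : MDifferentiableAt I' 𝓘(ℝ, W) f y)
    (hν : MDifferentiableAt I' 𝓘(ℝ, W) ν y) :
    MDifferentiableAt I' 𝓘(ℝ, W).tangent
      (fun x ↦ (TotalSpace.mk' W (f x) (ν x) : TangentBundle 𝓘(ℝ, W) W)) y := by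
  rw [ModelWithCorners.tangent, mdifferentiableAt_totalSpace]
  refine ⟨hf, ?_⟩
  simp only [trivializationAt_model_space_apply]
  exact hν

variable [FiniteDimensional ℝ W] [(euclideanMetric W).HasLeviCivita]

/-- **`D_v ν` is the derivative of `ν` along the chart-straight curve**: by definition
(`Hypersurface.lean`) `D_v ν = D(ν ∘ c)/dt (0)` for `c = curveThrough I' y v`, and the flat
covariant derivative along a curve is the ordinary derivative
(`covariantDerivAlong_eq_of_hasDerivAt`). O'Neill 1983, Ch. 4, Lemma 4.1 (flat case).
[cite: ONeill1983, Ch. 4, Lemma 4.1] -/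
theorem normalDerivAlong_eq_of_hasDerivAt {f : N → W} {ν : N → W} {y : N} {v : TangentSpace I' y}
    {V' : W} (hν : HasDerivAt (ν ∘ curveThrough I' y v) V' 0) :
    (euclideanMetric W).normalDerivAlong f ν y v = V' :=
  covariantDerivAlong_eq_of_hasDerivAt hν

variable [I'.Boundaryless] [IsManifold I' ∞ N]

/-- **`D_v ν = dν_y(v)`** for a smooth field `ν : N → W` along `f` (flat ambient space).
[cite: ONeill1983, Ch. 4, Lemma 4.1] -/
theorem normalDerivAlong_eq_mfderiv {f : N → W} {ν : N → W} (hν : ContMDiff I' 𝓘(ℝ, W) ∞ ν)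
    (y : N) (v : TangentSpace I' y) :
    (euclideanMetric W).normalDerivAlong f ν y v =
      (mfderiv I' 𝓘(ℝ, W) ν y : TangentSpace I' y →L[ℝ] W) v :=
  normalDerivAlong_eq_of_hasDerivAt (hasDerivAt_comp_curveThrough_zero hν y v)

omit [FiniteDimensional ℝ W] [(euclideanMetric W).HasLeviCivita] in
/-- **Normality along the curve**: if `ν` is normal to `f` (`⟪ν, df ·⟫ = 0`, `IsNormalTo`) then
`⟪ν(c t), (f ∘ c)'(t)⟫ = 0` along `c = curveThrough I' y u` (chain rule). [folklore] -/
theorem inner_deriv_comp_curveThrough {f ν : N → W} (hf : ContMDiff I' 𝓘(ℝ, W) ∞ f)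
    (hn : (euclideanMetric W).IsNormalTo I' f ν) (y : N) (u : TangentSpace I' y) {t : ℝ}
    (ht : extChartAt I' y y + t • (show E' from u) ∈ (extChartAt I' y).target) :
    ⟪ν (curveThrough I' y u t), deriv (f ∘ curveThrough I' y u) t⟫ = 0 := by
  rw [(hasDerivAt_comp_curveThrough hf y u ht).deriv]
  have := hn (curveThrough I' y u t) (velocity I' (curveThrough I' y u) t)
  rw [euclideanMetric_apply] at this
  exact this

variable [FiniteDimensional ℝ E']

/-- **The second fundamental form in Euclidean space is `K_ν(v, w) = ⟪dν_y v, df_y w⟫`**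
(tree convention `K_ν(v, w) = g(D_v ν, df w)`, `secondFundamentalForm_apply`, with
`normalDerivAlong_eq_mfderiv`). O'Neill 1983, Ch. 4, Lemma 4.1 and pp. 98–100; Mantegazza 2011,
§1.1 (`h_{ij} = -⟨ν, ∂²_{ij}φ⟩ = ⟨∂_i ν, ∂_j φ⟩`). [cite: ONeill1983, Ch. 4, Lemma 4.1] -/
theorem secondFundamentalForm_eq_inner {f ν : N → W} (hf : ContMDiff I' 𝓘(ℝ, W) ∞ f)
    (hν : ContMDiff I' 𝓘(ℝ, W) ∞ ν) (y : N) (v w : TangentSpace I' y) :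
    (euclideanMetric W).secondFundamentalForm I' f ν y v w =
      ⟪(mfderiv I' 𝓘(ℝ, W) ν y : TangentSpace I' y →L[ℝ] W) v,
        (mfderiv I' 𝓘(ℝ, W) f y : TangentSpace I' y →L[ℝ] W) w⟫ := by
  have hl := mdifferentiableAt_lift ((hf y).mdifferentiableAt (by simp))
    ((hν y).mdifferentiableAt (by simp))
  rw [secondFundamentalForm_apply_holds (I' := I') BoundarylessManifold.isInteriorPoint hl v w,
    euclideanMetric_apply, normalDerivAlong_eq_mfderiv hν y v]
  rfl

/-- **`K_ν(u, u) = -⟪ν(y), β''(0)⟫` with `β = f ∘ curveThrough I' y u`**: differentiating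
`⟪ν(c t), β'(t)⟫ = 0` (`inner_deriv_comp_curveThrough`) at `t = 0` gives
`⟪dν_y u, df_y u⟫ + ⟪ν(y), β''(0)⟫ = 0`, and the first term is `K_ν(u, u)`
(`secondFundamentalForm_eq_inner`, `hasDerivAt_comp_curveThrough_zero`). Mantegazza 2011, §1.1
(`h_{ij} = -⟨ν, ∂²φ/∂xᵢ∂xⱼ⟩`). [cite: Mantegazza2011, §1.1] -/
theorem secondFundamentalForm_self_eq_neg_inner {f ν : N → W} (hf : ContMDiff I' 𝓘(ℝ, W) ∞ f)
    (hν : ContMDiff I' 𝓘(ℝ, W) ∞ ν) (hn : (euclideanMetric W).IsNormalTo I' f ν) (y : N)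
    (u : TangentSpace I' y) :
    (euclideanMetric W).secondFundamentalForm I' f ν y u u =
      -⟪ν y, deriv (deriv (f ∘ curveThrough I' y u)) 0⟫ := by
  have hβ0 : ContDiffAt ℝ ∞ (f ∘ curveThrough I' y u) 0 :=
    (eventually_contDiffAt_comp_curveThrough hf y u).self_of_nhds
  have hβ2 := hasDerivAt_deriv_of_contDiffAt hβ0
  have hnc : HasDerivAt (ν ∘ curveThrough I' y u)
      ((mfderiv I' 𝓘(ℝ, W) ν y : TangentSpace I' y →L[ℝ] W) u) 0 :=
    hasDerivAt_comp_curveThrough_zero hν y u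
  have hzero : (fun t ↦ ⟪(ν ∘ curveThrough I' y u) t, deriv (f ∘ curveThrough I' y u) t⟫) =ᶠ[𝓝 0]
      fun _ ↦ (0 : ℝ) := by
    filter_upwards [eventually_lineThrough_mem_target y u] with t ht
    exact inner_deriv_comp_curveThrough hf hn y u ht
  have hprod := hnc.inner ℝ hβ2
  have h0 : deriv (fun t ↦ ⟪(ν ∘ curveThrough I' y u) t, deriv (f ∘ curveThrough I' y u) t⟫) 0
      = 0 := by
    rw [hzero.deriv_eq, deriv_const]
  rw [hprod.deriv] at h0
  simp only [comp_apply, curveThrough_zero] at h0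
  rw [secondFundamentalForm_eq_inner hf hν y u u, ← (hasDerivAt_comp_curveThrough_zero hf y u).deriv]
  rw [add_comm, add_eq_zero_iff_eq_neg] at h0
  exact h0

/-- **The mean curvature is `H(y) = -⟪ν(y), ∑ᵢ βᵢ''(0)⟫`**, `βᵢ = f ∘ curveThrough I' y bᵢ`, for
any `f^*δ`-orthonormal basis `b` of `T_y N` of a spacelike (= arbitrary, the ambient metric being
Riemannian) immersion `f` with smooth normal field `ν` (`H = tr_{f^*δ} K`,
`trace_eq_sum_of_isOrthonormalFrame`, `secondFundamentalForm_self_eq_neg_inner`): `-H ν` is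
the normal part of `∑ᵢ βᵢ''(0) = Δ_{f^*δ} f (y)`, the mean curvature vector. Mantegazza 2011,
§1.1 (`H⃗ = Δ_g φ = -H ν` up to the sign convention of the tree). [cite: Mantegazza2011, §1.1] -/
theorem meanCurvature_eq_neg_inner_sum {f ν : N → W}
    (hpb : contMDiff_pullbackBilin 𝓘(ℝ, W) W I' N ∞)
    (hf : (euclideanMetric W).IsSpacelikeImmersion I' f) (hν : ContMDiff I' 𝓘(ℝ, W) ∞ ν)
    (hn : (euclideanMetric W).IsNormalTo I' f ν) {y : N} {ι : Type*} [Fintype ι]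
    (b : Module.Basis ι ℝ (TangentSpace I' y))
    (hb : ((euclideanMetric W).inducedMetric f hpb hf).IsOrthonormalFrame y b) :
    (euclideanMetric W).meanCurvature f hpb hf ν y =
      -⟪ν y, ∑ i, deriv (deriv (f ∘ curveThrough I' y (b i))) 0⟫ := by
  rw [meanCurvature, PseudoRiemannianMetric.trace_eq_sum_of_isOrthonormalFrame _ b hb]
  have h : ∀ i, (euclideanMetric W).secondFundamentalForm I' f ν y (b i) (b i) =
      -⟪ν y, deriv (deriv (f ∘ curveThrough I' y (b i))) 0⟫ := fun i ↦
    secondFundamentalForm_self_eq_neg_inner hf.contMDiff_self hν hn y (b i)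
  rw [Finset.sum_congr rfl fun i _ ↦ h i, inner_sum, Finset.sum_neg_distrib]

end Flat

/-! ### A one-variable second-order test; linear algebra of codimension-one images -/

section Aux

/-- **Second-order necessary condition at a local minimum (one variable).** If `χ` has derivative
`χ'` near `0`, `χ'` is differentiable at `0` with derivative `c`, and `0` is a local minimum of
`χ`, then `c ≥ 0`. (If `c < 0`, Mathlib's second-derivative test `isLocalMax_of_deriv_deriv_neg`
makes `0` also a local maximum, so `χ` is locally constant and `c = 0`.) [folklore] -/
theorem deriv2_nonneg_of_isLocalMin {χ χ' : ℝ → ℝ} {c : ℝ}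
    (hχ : ∀ᶠ s in 𝓝 (0 : ℝ), HasDerivAt χ (χ' s) s) (hχ' : HasDerivAt χ' c 0)
    (hmin : IsLocalMin χ 0) : 0 ≤ c := by
  by_contra hc
  push Not at hc
  have hderiv : deriv χ =ᶠ[𝓝 0] χ' := hχ.mono fun s hs ↦ hs.deriv
  have hd0 : HasDerivAt χ (χ' 0) 0 := hχ.self_of_nhds
  have h1 : χ' 0 = 0 := hmin.hasDerivAt_eq_zero hd0
  have hd1 : deriv χ 0 = 0 := by rw [hd0.deriv, h1]
  have hd2 : deriv (deriv χ) 0 < 0 := by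
    rw [hderiv.deriv_eq, hχ'.deriv]; exact hc
  have hmax : IsLocalMax χ 0 := isLocalMax_of_deriv_deriv_neg hd2 hd1 hd0.continuousAt
  -- `χ` is constant near `0`, so `deriv χ = 0` near `0` and `deriv (deriv χ) 0 = 0`
  have hconst : ∀ᶠ s in 𝓝 (0 : ℝ), χ s = χ 0 :=
    (hmin.and hmax).mono fun s hs ↦ le_antisymm hs.2 hs.1
  have hloc : ∀ᶠ s in 𝓝 (0 : ℝ), deriv χ s = 0 := by
    filter_upwards [hconst.eventually_nhds] with s hs
    have : χ =ᶠ[𝓝 s] fun _ ↦ χ 0 := hs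
    rw [this.deriv_eq, deriv_const]
  have hc0 : deriv (deriv χ) 0 = 0 := by
    have : deriv χ =ᶠ[𝓝 0] fun _ ↦ (0 : ℝ) := hloc
    rw [this.deriv_eq, deriv_const]
  rw [hc0] at hd2
  exact lt_irrefl _ hd2

variable {W : Type*} [NormedAddCommGroup W] [InnerProductSpace ℝ W]
  {E₁ : Type*} [AddCommGroup E₁] [Module ℝ E₁]
  {E₂ : Type*} [AddCommGroup E₂] [Module ℝ E₂]

/-- The image of a linear map orthogonal to `w` lies in `(ℝ w)ᗮ`. [folklore] -/
theorem range_le_orthogonal_span (A : E₁ →ₗ[ℝ] W) {w : W} (hw : ∀ v, ⟪A v, w⟫ = 0) :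
    LinearMap.range A ≤ (ℝ ∙ w)ᗮ := by
  rintro _ ⟨v, rfl⟩
  rw [Submodule.mem_orthogonal_singleton_iff_inner_right, real_inner_comm]
  exact hw v

variable [FiniteDimensional ℝ W]

/-- **A vector orthogonal to an injective codimension-one image is a multiple of the unit normal**:
if `A : E₁ → W` is injective linear with `dim E₁ + 1 = dim W`, `ν` is a unit vector orthogonal to
the image and `w` is orthogonal to the image, then `w = ⟪ν, w⟫ ν` (the orthogonal complement of
the image is the line `ℝ ν`). [folklore] -/
theorem eq_inner_smul_of_forall_inner_eq_zero (A : E₁ →ₗ[ℝ] W) (hA : Injective A)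
    (hdim : finrank ℝ E₁ + 1 = finrank ℝ W) {ν w : W} (hν : ‖ν‖ = 1)
    (hνA : ∀ v, ⟪A v, ν⟫ = 0) (hwA : ∀ v, ⟪A v, w⟫ = 0) : w = ⟪ν, w⟫ • ν := by
  set K : Submodule ℝ W := LinearMap.range A with hK
  have hfinK : finrank ℝ K = finrank ℝ E₁ := LinearMap.finrank_range_of_inj hA
  have hfin : finrank ℝ Kᗮ = 1 := by
    have h := Submodule.finrank_add_finrank_orthogonal K
    omega
  have hmem : ∀ {z : W}, (∀ v, ⟪A v, z⟫ = 0) → z ∈ Kᗮ := fun hz ↦ by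
    rw [Submodule.mem_orthogonal]
    rintro _ ⟨v, rfl⟩
    exact hz v
  have hν0 : (⟨ν, hmem hνA⟩ : Kᗮ) ≠ 0 := by
    intro h
    have : ν = 0 := congrArg Subtype.val h
    rw [this, norm_zero] at hν
    exact zero_ne_one hν
  obtain ⟨c, hc⟩ := (finrank_eq_one_iff_of_nonzero' _ hν0).1 hfin ⟨w, hmem hwA⟩
  have hc' : c • ν = w := congrArg Subtype.val hc
  have hcν : ⟪ν, w⟫ = c := by
    rw [← hc', real_inner_smul_right, real_inner_self_eq_norm_sq, hν]; ring
  rw [hcν, hc']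

/-- **An injective codimension-one image orthogonal to `w ≠ 0` is the hyperplane `(ℝ w)ᗮ`**
(dimension count). [folklore] -/
theorem range_eq_orthogonal_span [FiniteDimensional ℝ E₁] (A : E₁ →ₗ[ℝ] W) (hA : Injective A)
    (hdim : finrank ℝ E₁ + 1 = finrank ℝ W) {w : W} (hw : w ≠ 0) (hwA : ∀ v, ⟪A v, w⟫ = 0) :
    LinearMap.range A = (ℝ ∙ w)ᗮ := by
  refine Submodule.eq_of_le_of_finrank_eq (range_le_orthogonal_span A hwA) ?_
  have h := Submodule.finrank_add_finrank_orthogonal (ℝ ∙ w)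
  rw [finrank_span_singleton hw] at h
  rw [LinearMap.finrank_range_of_inj hA]
  omega

/-- **Two injective codimension-one images orthogonal to the same nonzero vector coincide**: the
two tangent hyperplanes at a distance-minimising pair are parallel (Mantegazza 2011, proof of
Thm. 2.2.1: "`T_{X(p)}M_t` and `T_{Y(q)}N_t` have to be parallel"). [cite: Mantegazza2011, Thm. 2.2.1 (proof)] -/
theorem range_eq_range_of_forall_inner_eq_zero [FiniteDimensional ℝ E₁] [FiniteDimensional ℝ E₂]
    (A₁ : E₁ →ₗ[ℝ] W) (A₂ : E₂ →ₗ[ℝ] W) (h₁ : Injective A₁) (h₂ : Injective A₂)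
    (hd₁ : finrank ℝ E₁ + 1 = finrank ℝ W) (hd₂ : finrank ℝ E₂ + 1 = finrank ℝ W) {w : W}
    (hw : w ≠ 0) (hw₁ : ∀ v, ⟪A₁ v, w⟫ = 0) (hw₂ : ∀ v, ⟪A₂ v, w⟫ = 0) :
    LinearMap.range A₁ = LinearMap.range A₂ := by
  rw [range_eq_orthogonal_span A₁ h₁ hd₁ hw hw₁, range_eq_orthogonal_span A₂ h₂ hd₂ hw hw₂]

omit [FiniteDimensional ℝ W] in
/-- **Basis transfer**: if `A₁ ∘ b₁` is orthonormal and `A₂ (u' i) = A₁ (b₁ i)` for a family `u'`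
of `m = dim E₂` vectors, then `u'` is a basis of `E₂`. [folklore] -/
theorem exists_basis_eq [FiniteDimensional ℝ E₂] {m : ℕ} (hm : finrank ℝ E₂ = m)
    (A₁ : E₁ →ₗ[ℝ] W) (A₂ : E₂ →ₗ[ℝ] W) (b₁ : Fin m → E₁)
    (hon : Orthonormal ℝ (fun i ↦ A₁ (b₁ i))) (u' : Fin m → E₂)
    (hu' : ∀ i, A₂ (u' i) = A₁ (b₁ i)) : ∃ b₂ : Module.Basis (Fin m) ℝ E₂, ∀ i, b₂ i = u' i := by
  have hcomp : (fun i ↦ A₂ (u' i)) = fun i ↦ A₁ (b₁ i) := funext hu'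
  have hli : LinearIndependent ℝ u' := by
    refine LinearIndependent.of_comp A₂ ?_
    change LinearIndependent ℝ (fun i ↦ A₂ (u' i))
    rw [hcomp]
    exact hon.linearIndependent
  exact ⟨Module.Basis.mk hli (hli.span_eq_top_of_card_eq_finrank' (by simp [hm])).ge, fun i ↦
    Module.Basis.mk_apply hli _ i⟩

end Aux

/-! ### Two immersed hypersurfaces at a distance-minimising pair of points -/

section Contact

variable {E' : Type*} [NormedAddCommGroup E'] [NormedSpace ℝ E']
  {H' : Type*} [TopologicalSpace H'] {I' : ModelWithCorners ℝ E' H'} [I'.Boundaryless]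
  {N₁ : Type*} [TopologicalSpace N₁] [ChartedSpace H' N₁] [IsManifold I' ∞ N₁]
  {N₂ : Type*} [TopologicalSpace N₂] [ChartedSpace H' N₂] [IsManifold I' ∞ N₂]
  {W : Type*} [NormedAddCommGroup W] [InnerProductSpace ℝ W]

omit [IsManifold I' ∞ N₂] in
/-- **First-order condition: the connecting vector is normal.** If `p` minimises `‖f · - z‖` over
`N₁` then `⟪df_p u, f p - z⟫ = 0` for all `u ∈ T_p N₁` (Fermat for `s ↦ ‖f(c s) - z‖²` along the
chart-straight curve of velocity `u`). Mantegazza 2011, proof of Thm. 2.2.1.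
[cite: Mantegazza2011, Thm. 2.2.1 (proof)] -/
theorem inner_mfderiv_eq_zero_of_forall_norm_le {f : N₁ → W} (hf : ContMDiff I' 𝓘(ℝ, W) ∞ f)
    {p : N₁} {z : W} (hmin : ∀ p', ‖f p - z‖ ≤ ‖f p' - z‖) (u : TangentSpace I' p) :
    ⟪(mfderiv I' 𝓘(ℝ, W) f p : TangentSpace I' p →L[ℝ] W) u, f p - z⟫ = 0 := by
  have hd := ((hasDerivAt_comp_curveThrough_zero hf p u).sub_const z).norm_sq
  have hlm : IsLocalMin (fun s ↦ ‖(f ∘ curveThrough I' p u) s - z‖ ^ 2) 0 :=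
    Filter.Eventually.of_forall fun s ↦ by
      simp only [comp_apply, curveThrough_zero]
      exact pow_le_pow_left₀ (norm_nonneg _) (hmin _) 2
  have h0 := hlm.hasDerivAt_eq_zero hd
  simp only [comp_apply, curveThrough_zero, mul_eq_zero, OfNat.ofNat_ne_zero, false_or] at h0
  rw [real_inner_comm]
  exact h0

/-- **Second-order condition along a matched pair of directions.** If `(p, q)` minimises
`‖f₁ p' - f₂ q'‖` over `N₁ × N₂` and `u ∈ T_p N₁`, `u' ∈ T_q N₂` have `df₂ u' = df₁ u`, then with
`βᵢ = fᵢ ∘ cᵢ` the chart-straight curves of velocities `u, u'`: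
`⟪f₁ p - f₂ q, β₁''(0)⟫ - ⟪f₁ p - f₂ q, β₂''(0)⟫ ≥ 0` — the second derivative at the minimum
`s = 0` of `χ(s) = ‖β₁ s - β₂ s‖²` is `2‖β₁'(0) - β₂'(0)‖² + 2⟪β₁ - β₂, β₁'' - β₂''⟫(0) ≥ 0` and the
first term vanishes. Mantegazza 2011, proof of Thm. 2.2.1 (there via the graphs `f, h` over the
common tangent plane: `Δf(0) - Δh(0) ≥ 0`). [cite: Mantegazza2011, Thm. 2.2.1 (proof)] -/
theorem second_order_pair {f₁ : N₁ → W} {f₂ : N₂ → W} (hf₁ : ContMDiff I' 𝓘(ℝ, W) ∞ f₁)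
    (hf₂ : ContMDiff I' 𝓘(ℝ, W) ∞ f₂) {p : N₁} {q : N₂}
    (hmin : ∀ p' q', ‖f₁ p - f₂ q‖ ≤ ‖f₁ p' - f₂ q'‖) {u : TangentSpace I' p}
    {u' : TangentSpace I' q}
    (huu' : (mfderiv I' 𝓘(ℝ, W) f₂ q : TangentSpace I' q →L[ℝ] W) u' =
      (mfderiv I' 𝓘(ℝ, W) f₁ p : TangentSpace I' p →L[ℝ] W) u) :
    0 ≤ ⟪f₁ p - f₂ q, deriv (deriv (f₁ ∘ curveThrough I' p u)) 0⟫ -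
      ⟪f₁ p - f₂ q, deriv (deriv (f₂ ∘ curveThrough I' q u')) 0⟫ := by
  have hd₁ : ∀ᶠ s in 𝓝 (0 : ℝ), HasDerivAt (f₁ ∘ curveThrough I' p u)
      (deriv (f₁ ∘ curveThrough I' p u) s) s :=
    (eventually_contDiffAt_comp_curveThrough hf₁ p u).mono fun s hs ↦
      (hs.differentiableAt (by simp)).hasDerivAt
  have hd₂ : ∀ᶠ s in 𝓝 (0 : ℝ), HasDerivAt (f₂ ∘ curveThrough I' q u')
      (deriv (f₂ ∘ curveThrough I' q u') s) s :=
    (eventually_contDiffAt_comp_curveThrough hf₂ q u').mono fun s hs ↦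
      (hs.differentiableAt (by simp)).hasDerivAt
  have hdd₁ := hasDerivAt_deriv_of_contDiffAt
    (eventually_contDiffAt_comp_curveThrough hf₁ p u).self_of_nhds
  have hdd₂ := hasDerivAt_deriv_of_contDiffAt
    (eventually_contDiffAt_comp_curveThrough hf₂ q u').self_of_nhds
  have h0₁ := (hasDerivAt_comp_curveThrough_zero hf₁ p u).deriv
  have h0₂ := (hasDerivAt_comp_curveThrough_zero hf₂ q u').deriv
  -- `χ(s) = ‖β₁ s - β₂ s‖²` and its first two derivatives at `0`
  have hχ : ∀ᶠ s in 𝓝 (0 : ℝ), HasDerivAt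
      (fun s ↦ ‖(f₁ ∘ curveThrough I' p u) s - (f₂ ∘ curveThrough I' q u') s‖ ^ 2)
      (2 * ⟪(f₁ ∘ curveThrough I' p u) s - (f₂ ∘ curveThrough I' q u') s,
        deriv (f₁ ∘ curveThrough I' p u) s - deriv (f₂ ∘ curveThrough I' q u') s⟫) s :=
    (hd₁.and hd₂).mono fun s hs ↦ (hs.1.sub hs.2).norm_sq
  have hχ' := ((hd₁.self_of_nhds.sub hd₂.self_of_nhds).inner ℝ (hdd₁.sub hdd₂)).const_mul (2 : ℝ)
  have hlm : IsLocalMin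
      (fun s ↦ ‖(f₁ ∘ curveThrough I' p u) s - (f₂ ∘ curveThrough I' q u') s‖ ^ 2) 0 :=
    Filter.Eventually.of_forall fun s ↦ by
      simp only [comp_apply, curveThrough_zero]
      exact pow_le_pow_left₀ (norm_nonneg _) (hmin _ _) 2
  have key := deriv2_nonneg_of_isLocalMin hχ hχ' hlm
  -- the first-order terms cancel: `β₁'(0) - β₂'(0) = df₁ u - df₂ u' = 0`
  have hcancel : deriv (f₁ ∘ curveThrough I' p u) 0 - deriv (f₂ ∘ curveThrough I' q u') 0 = 0 := by
    rw [h0₁, h0₂, huu', sub_self]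
  rw [hcancel, inner_zero_left, add_zero] at key
  simp only [Pi.sub_apply, comp_apply, curveThrough_zero] at key
  rw [inner_sub_right] at key
  linarith

variable [FiniteDimensional ℝ E'] [FiniteDimensional ℝ W] [(euclideanMetric W).HasLeviCivita]

/-- **Comparison of mean curvatures at a distance-minimising pair** (Mantegazza 2011, proof of
Thm. 2.2.1; the geometric input of the comparison / avoidance principle for mean curvature flow).
Let `f₁ : N₁ → W`, `f₂ : N₂ → W` be immersed hypersurfaces of the Euclidean space `W`
(`dim Nᵢ + 1 = dim W`) with unit normal fields `ν₁, ν₂` (smooth as maps into `W`), and let `(p, q)`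
minimise `‖f₁ p' - f₂ q'‖` over `N₁ × N₂`. Then, with `Hᵢ` the mean curvatures (tree convention:
`∂ₜF = -H ν` is mean curvature flow),

  `⟪H₂(q) ν₂(q) - H₁(p) ν₁(p), f₁ p - f₂ q⟫ ≥ 0`,

i.e. `∂ₜ ‖F₁(p) - F₂(q)‖² = 2⟪-H₁ν₁ + H₂ν₂, F₁ p - F₂ q⟫ ≥ 0` at a minimising pair of two mean
curvature flows. Proof as in the module docstring: first-order conditions, `w = ⟪νᵢ, w⟫ νᵢ`,
parallel tangent hyperplanes, the matched second-order inequalities `second_order_pair` rewritten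
through `K(u, u) = -⟪ν, β''(0)⟫`, summed over matched orthonormal frames
(`H = ∑ᵢ K(bᵢ, bᵢ)`). [cite: Mantegazza2011, Thm. 2.2.1 (proof)]
[cite: RitoreSinestrari2010, Thm. 4.2] -/
theorem inner_meanCurvature_smul_sub_nonneg {f₁ ν₁ : N₁ → W} {f₂ ν₂ : N₂ → W}
    (hpb₁ : contMDiff_pullbackBilin 𝓘(ℝ, W) W I' N₁ ∞)
    (hpb₂ : contMDiff_pullbackBilin 𝓘(ℝ, W) W I' N₂ ∞)
    (hf₁ : (euclideanMetric W).IsSpacelikeImmersion I' f₁)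
    (hf₂ : (euclideanMetric W).IsSpacelikeImmersion I' f₂)
    (hν₁ : (euclideanMetric W).IsUnitNormal I' f₁ ν₁ 1) (hν₁s : ContMDiff I' 𝓘(ℝ, W) ∞ ν₁)
    (hν₂ : (euclideanMetric W).IsUnitNormal I' f₂ ν₂ 1) (hν₂s : ContMDiff I' 𝓘(ℝ, W) ∞ ν₂)
    (hdim : finrank ℝ E' + 1 = finrank ℝ W) {p : N₁} {q : N₂}
    (hmin : ∀ p' q', ‖f₁ p - f₂ q‖ ≤ ‖f₁ p' - f₂ q'‖) :
    0 ≤ ⟪(euclideanMetric W).meanCurvature f₂ hpb₂ hf₂ ν₂ q • ν₂ q -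
        (euclideanMetric W).meanCurvature f₁ hpb₁ hf₁ ν₁ p • ν₁ p, f₁ p - f₂ q⟫ := by
  by_cases hw : f₁ p - f₂ q = 0
  · rw [hw, inner_zero_right]
  have hf₁s : ContMDiff I' 𝓘(ℝ, W) ∞ f₁ := hf₁.contMDiff_self
  have hf₂s : ContMDiff I' 𝓘(ℝ, W) ∞ f₂ := hf₂.contMDiff_self
  set A₁ : E' →L[ℝ] W := mfderiv I' 𝓘(ℝ, W) f₁ p with hA₁
  set A₂ : E' →L[ℝ] W := mfderiv I' 𝓘(ℝ, W) f₂ q with hA₂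
  have hA₁i : Injective A₁ := hf₁.injective_mfderiv p
  have hA₂i : Injective A₂ := hf₂.injective_mfderiv q
  -- first order: the connecting vector `w = f₁ p - f₂ q` is normal to both hypersurfaces
  have hw₁ : ∀ v, ⟪A₁ v, f₁ p - f₂ q⟫ = 0 := fun v ↦
    inner_mfderiv_eq_zero_of_forall_norm_le hf₁s (fun p' ↦ hmin p' q) v
  have hw₂ : ∀ v, ⟪A₂ v, f₁ p - f₂ q⟫ = 0 := fun v ↦ by
    have h := inner_mfderiv_eq_zero_of_forall_norm_le hf₂s (z := f₁ p) (p := q)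
      (fun q' ↦ by rw [norm_sub_rev, norm_sub_rev (f₂ q')]; exact hmin p q') v
    have h' : ⟪A₂ v, f₂ q - f₁ p⟫ = 0 := h
    rw [← neg_sub, inner_neg_right, h', neg_zero]
  -- unit normals
  have hn₁ : ∀ v, ⟪A₁ v, ν₁ p⟫ = 0 := fun v ↦ by
    have h : ⟪ν₁ p, A₁ v⟫ = 0 := hν₁.isNormalTo p v
    rw [real_inner_comm]; exact h
  have hn₂ : ∀ v, ⟪A₂ v, ν₂ q⟫ = 0 := fun v ↦ by
    have h : ⟪ν₂ q, A₂ v⟫ = 0 := hν₂.isNormalTo q v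
    rw [real_inner_comm]; exact h
  have hu₁ : ‖ν₁ p‖ = 1 := by
    have h : ⟪ν₁ p, ν₁ p⟫ = (1 : ℝ) := hν₁.val_self p
    rw [real_inner_self_eq_norm_sq] at h
    rw [← Real.sqrt_sq (norm_nonneg (ν₁ p)), h, Real.sqrt_one]
  have hu₂ : ‖ν₂ q‖ = 1 := by
    have h : ⟪ν₂ q, ν₂ q⟫ = (1 : ℝ) := hν₂.val_self q
    rw [real_inner_self_eq_norm_sq] at h
    rw [← Real.sqrt_sq (norm_nonneg (ν₂ q)), h, Real.sqrt_one]
  have hwν₁ : f₁ p - f₂ q = ⟪ν₁ p, f₁ p - f₂ q⟫ • ν₁ p :=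
    eq_inner_smul_of_forall_inner_eq_zero A₁.toLinearMap hA₁i hdim hu₁ hn₁ hw₁
  have hwν₂ : f₁ p - f₂ q = ⟪ν₂ q, f₁ p - f₂ q⟫ • ν₂ q :=
    eq_inner_smul_of_forall_inner_eq_zero A₂.toLinearMap hA₂i hdim hu₂ hn₂ hw₂
  -- the tangent hyperplanes coincide: matched directions `φ u` with `df₂ (φ u) = df₁ u` exist
  have hrange : LinearMap.range A₁.toLinearMap = LinearMap.range A₂.toLinearMap :=
    range_eq_range_of_forall_inner_eq_zero A₁.toLinearMap A₂.toLinearMap hA₁i hA₂i hdim hdim hw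
      hw₁ hw₂
  have hex : ∀ u : E', ∃ u' : E', A₂ u' = A₁ u := fun u ↦ by
    have : A₁ u ∈ LinearMap.range A₂.toLinearMap := by
      rw [← hrange]; exact ⟨u, rfl⟩
    obtain ⟨u', hu'⟩ := this
    exact ⟨u', hu'⟩
  choose φ hφ using hex
  -- per matched pair: `-⟪ν₁, w⟫ K₁(u, u) + ⟪ν₂, w⟫ K₂(φ u, φ u) ≥ 0`
  have hpair : ∀ u : E',
      0 ≤ -(⟪ν₁ p, f₁ p - f₂ q⟫ * (euclideanMetric W).secondFundamentalForm I' f₁ ν₁ p u u) +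
        ⟪ν₂ q, f₁ p - f₂ q⟫ * (euclideanMetric W).secondFundamentalForm I' f₂ ν₂ q (φ u) (φ u) := by
    intro u
    have key := second_order_pair hf₁s hf₂s hmin (u := u) (u' := φ u) (hφ u)
    rw [secondFundamentalForm_self_eq_neg_inner hf₁s hν₁s hν₁.isNormalTo p u,
      secondFundamentalForm_self_eq_neg_inner hf₂s hν₂s hν₂.isNormalTo q (φ u)]
    have e₁ : ⟪f₁ p - f₂ q, deriv (deriv (f₁ ∘ curveThrough I' p u)) 0⟫ =
        ⟪ν₁ p, f₁ p - f₂ q⟫ * ⟪ν₁ p, deriv (deriv (f₁ ∘ curveThrough I' p u)) 0⟫ := by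
      conv_lhs => rw [hwν₁]
      rw [real_inner_smul_left]
    have e₂ : ⟪f₁ p - f₂ q, deriv (deriv (f₂ ∘ curveThrough I' q (φ u))) 0⟫ =
        ⟪ν₂ q, f₁ p - f₂ q⟫ * ⟪ν₂ q, deriv (deriv (f₂ ∘ curveThrough I' q (φ u))) 0⟫ := by
      conv_lhs => rw [hwν₂]
      rw [real_inner_smul_left]
    rw [e₁, e₂] at key
    linarith
  -- orthonormal frames: `b₁` for `f₁^*δ` at `p`, transferred to `b₂ i = φ (b₁ i)` for `f₂^*δ` at `q`
  set g₁ := (euclideanMetric W).inducedMetric f₁ hpb₁ hf₁ with hg₁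
  set g₂ := (euclideanMetric W).inducedMetric f₂ hpb₂ hf₂ with hg₂
  have hval₁ : ∀ v w : TangentSpace I' p, g₁.val p v w = ⟪A₁ v, A₁ w⟫ := fun v w ↦ by
    rw [hg₁, inducedMetric_val, inducedBilin_apply, euclideanMetric_apply]
    rfl
  have hval₂ : ∀ v w : TangentSpace I' q, g₂.val q v w = ⟪A₂ v, A₂ w⟫ := fun v w ↦ by
    rw [hg₂, inducedMetric_val, inducedBilin_apply, euclideanMetric_apply]
    rfl
  have hpos₁ : ∀ v : TangentSpace I' p, v ≠ 0 → 0 < g₁.val p v v :=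
    fun v hv ↦ isRiemannian_inducedMetric _ _ hpb₁ hf₁ p v hv
  obtain ⟨b₁, hb₁⟩ := g₁.exists_basis_isOrthonormalFrame hpos₁ (m := finrank ℝ E') rfl
  have hon : Orthonormal ℝ (fun i ↦ A₁ (b₁ i)) := by
    rw [orthonormal_iff_ite]
    intro i j
    rw [← hval₁]
    by_cases hij : i = j
    · subst hij; simp [hb₁.1 i]
    · simp [hb₁.2 i j hij, hij]
  obtain ⟨b₂, hb₂⟩ := exists_basis_eq (E₂ := E') rfl A₁.toLinearMap A₂.toLinearMap
    (fun i ↦ b₁ i) hon (fun i ↦ φ (b₁ i)) (fun i ↦ hφ (b₁ i))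
  have hb₂on : g₂.IsOrthonormalFrame q b₂ := by
    refine ⟨fun i ↦ ?_, fun i j hij ↦ ?_⟩
    · rw [hval₂, hb₂, hφ, ← hval₁]; exact hb₁.1 i
    · rw [hval₂, hb₂, hb₂, hφ, hφ, ← hval₁]; exact hb₁.2 i j hij
  -- mean curvatures as sums over the frames; sum the matched inequalities
  have hH₁ : (euclideanMetric W).meanCurvature f₁ hpb₁ hf₁ ν₁ p =
      ∑ i, (euclideanMetric W).secondFundamentalForm I' f₁ ν₁ p (b₁ i) (b₁ i) := by
    rw [meanCurvature, g₁.trace_eq_sum_of_isOrthonormalFrame b₁ hb₁]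
  have hH₂ : (euclideanMetric W).meanCurvature f₂ hpb₂ hf₂ ν₂ q =
      ∑ i, (euclideanMetric W).secondFundamentalForm I' f₂ ν₂ q (φ (b₁ i)) (φ (b₁ i)) := by
    rw [meanCurvature, g₂.trace_eq_sum_of_isOrthonormalFrame b₂ hb₂on]
    exact Finset.sum_congr rfl fun i _ ↦
      congrArg₂ (fun a b ↦ (euclideanMetric W).secondFundamentalForm I' f₂ ν₂ q a b) (hb₂ i) (hb₂ i)
  have hsum := Finset.sum_nonneg fun i (_ : i ∈ Finset.univ) ↦ hpair (b₁ i)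
  rw [Finset.sum_add_distrib, Finset.sum_neg_distrib, ← Finset.mul_sum, ← Finset.mul_sum,
    ← hH₁, ← hH₂] at hsum
  rw [inner_sub_left, real_inner_smul_left, real_inner_smul_left]
  linarith

end Contact

end EuclideanHypersurface

end Literature.Geometry.Riemannian

end
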